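import Summits.CriticalPhenomena.SAWScalingLimit.Theorems.SAWDefectDecoherenceBoundaryClosureRBoundaryExactness
import Summits.CriticalPhenomena.SAWScalingLimit.Theorems.SAWDefectDecoherenceBoundaryClosureRLocalL1Normaliser
import HarnessLib

/-!
# Gate trace from gate data: the gate darts carry ONE phase (normalised dart values are mass ratios)
(crux `BoundaryClosureR`, stmt-CriticalPhenomena-14004, line `polygon-parity-squeeze`, registered
stub `stub_gateTrace`, mechanism (C); registered sub-goal `gateTrace_dartRatio_eq_massRatio`)

The boundary term of the gate identity behind the missing limit `GateDbarLimit` (see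
`…GateTraceOfGateData.lean`) is the sum over the gate darts `e_k = floorEdge k m` of
`φ(δ c_v) (mid − c_v) F_{5/8}(e_k)`, normalised by `F_{5/8}(b_δ)` with `b_δ = e_{kb}` a dart of the same
flat floor.  Here: **on a flat floor not containing the root, `F_{5/8}(e_k)/F_{5/8}(e_{kb}) =
Z(e_k)/Z(e_{kb})`** (`Z = F_0`, the arrival masses), i.e. the normalised dart values are the
POSITIVE mass ratios that the gate profile law `GateProfileAt` controls.  Ingredients (all landed):
the phase factorisation `F_σ(e) = e^{-iσW(γ)} F_0(e)` at boundary mid-edges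
(`LocalL1.observable_eq_phase_mul_zero_spin_of_mem_boundary`, winding rigidity) and the straight
gate `BoundaryExactness.straightGate` (walks from the root to any two darts of one flat floor have
equal windings).  Degenerate cases (no walk to `e_k` or to `e_{kb}`) hold with both sides `0`.
-/

noncomputable section

open Literature.Probability.LatticeModels Literature.Probability.RandomPlanarGeometry
open Literature.Probability.RandomPlanarGeometry.SAW
open Summit.CriticalPhenomena.SAWScalingLimit.Theorems.PickHalfPlane

namespace Summit.CriticalPhenomena.SAWScalingLimit.Theorems.PolygonParitySqueeze.GateTrace

/-- **Normalised gate-dart values are mass ratios.** For a simply connected `Λ` rooted at the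
boundary mid-edge `{u, w}` (`u ∉ Λ ∋ w`) and a flat floor `k₁ … k₂` of row `m` (up faces `(k,m,0) ∈ Λ`,
faces `(k,m-1,1)` below them off `Λ`, down faces `(k,m,1)`, `k < k₂`, in `Λ`) none of whose darts is
the root, for any two darts `e_{kb}`, `e_{ke}` of the floor:
`F_{5/8}(e_{ke}) / F_{5/8}(e_{kb}) = F_0(e_{ke}) / F_0(e_{kb})` (equal windings from the root by the
straight gate, hence equal phases `e^{-i(5/8)W}`; if no walk reaches one of the darts both sides
vanish). [cite: DuminilCopinSmirnov2012, §3 (winding of walks to the boundary)] -/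
theorem dartRatio_eq_massRatio {Λ : Finset HexVertex} (hΛ : hexDomainSimplyConnected Λ)
    {u w : HexVertex} (huw : hexGraph.Adj u w) (hu : u ∉ Λ) (hw : w ∈ Λ) {m k₁ k₂ : ℤ}
    (hF : ∀ k : ℤ, k₁ ≤ k → k ≤ k₂ → ((![k, m], 0) : HexVertex) ∈ Λ ∧
      ((![k, m - 1], 1) : HexVertex) ∉ Λ ∧ (k < k₂ → ((![k, m], 1) : HexVertex) ∈ Λ))
    (hroot : ∀ k : ℤ, k₁ ≤ k → k ≤ k₂ →
      s(((![k, m - 1], 1) : HexVertex), ((![k, m], 0) : HexVertex)) ≠ s(u, w))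
    {kb ke : ℤ} (hkb₁ : k₁ ≤ kb) (hkb₂ : kb ≤ k₂) (hke₁ : k₁ ≤ ke) (hke₂ : ke ≤ k₂) :
    hexParafermionicObservable Λ s(u, w) hexCriticalFugacity (5 / 8)
        s(((![ke, m - 1], 1) : HexVertex), ((![ke, m], 0) : HexVertex)) /
      hexParafermionicObservable Λ s(u, w) hexCriticalFugacity (5 / 8)
        s(((![kb, m - 1], 1) : HexVertex), ((![kb, m], 0) : HexVertex)) =
    hexParafermionicObservable Λ s(u, w) hexCriticalFugacity 0
        s(((![ke, m - 1], 1) : HexVertex), ((![ke, m], 0) : HexVertex)) /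
      hexParafermionicObservable Λ s(u, w) hexCriticalFugacity 0
        s(((![kb, m - 1], 1) : HexVertex), ((![kb, m], 0) : HexVertex)) := by
  have ha : s(u, w) ∈ hexDomainBoundary Λ := BoundaryExactness.mk_mem_hexDomainBoundary huw hu hw
  have hbd : ∀ k, k₁ ≤ k → k ≤ k₂ →
      s(((![k, m - 1], 1) : HexVertex), ((![k, m], 0) : HexVertex)) ∈ hexDomainBoundary Λ :=
    fun k h1 h2 => BoundaryExactness.mk_mem_hexDomainBoundary (by rw [hexGraph_adj_iff_coord]; simp)
      (hF k h1 h2).2.1 (hF k h1 h2).1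
  -- degenerate cases: no walk to one of the two darts
  by_cases hne : Nonempty (HexMidEdgeSAW Λ s(u, w)
      s(((![ke, m - 1], 1) : HexVertex), ((![ke, m], 0) : HexVertex)))
  swap
  · rw [not_nonempty_iff] at hne
    have h0 : ∀ σ : ℝ, hexParafermionicObservable Λ s(u, w) hexCriticalFugacity σ
        s(((![ke, m - 1], 1) : HexVertex), ((![ke, m], 0) : HexVertex)) = 0 := fun σ => by
      rw [hexParafermionicObservable_def, Finset.univ_eq_empty, Finset.sum_empty]
    rw [h0, h0, zero_div, zero_div]
  by_cases hnb : Nonempty (HexMidEdgeSAW Λ s(u, w)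
      s(((![kb, m - 1], 1) : HexVertex), ((![kb, m], 0) : HexVertex)))
  swap
  · rw [not_nonempty_iff] at hnb
    have h0 : ∀ σ : ℝ, hexParafermionicObservable Λ s(u, w) hexCriticalFugacity σ
        s(((![kb, m - 1], 1) : HexVertex), ((![kb, m], 0) : HexVertex)) = 0 := fun σ => by
      rw [hexParafermionicObservable_def, Finset.univ_eq_empty, Finset.sum_empty]
    rw [h0, h0, div_zero, div_zero]
  obtain ⟨γe⟩ := hne
  obtain ⟨γb⟩ := hnb
  -- equal windings, equal phases
  have hW : γe.winding = γb.winding :=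
    BoundaryExactness.straightGate Λ hΛ u w huw hu hw m k₁ k₂ hF hroot kb ke hkb₁ hkb₂ hke₁ hke₂ γb γe
  rw [LocalL1.observable_eq_phase_mul_zero_spin_of_mem_boundary hΛ ha (hbd ke hke₁ hke₂) γe,
    LocalL1.observable_eq_phase_mul_zero_spin_of_mem_boundary hΛ ha (hbd kb hkb₁ hkb₂) γb, hW,
    mul_div_mul_left _ _ (Complex.exp_ne_zero _)]

/-- **Registered sub-goal `gateTrace_dartRatio_eq_massRatio`** (crux item stmt-CriticalPhenomena-14004,
line `polygon-parity-squeeze`, stub `stub_gateTrace`, mechanism (C), lattice side of `GateDbarLimit`):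
registry form (one `∀`-term) of `dartRatio_eq_massRatio`. [folklore] -/
theorem gateTrace_dartRatio_eq_massRatio : ∀ (Λ : Finset HexVertex), hexDomainSimplyConnected Λ → ∀ (u w : HexVertex), hexGraph.Adj u w → u ∉ Λ → w ∈ Λ → ∀ (m k₁ k₂ : ℤ), (∀ k : ℤ, k₁ ≤ k → k ≤ k₂ → ((![k, m], 0) : HexVertex) ∈ Λ ∧ ((![k, m - 1], 1) : HexVertex) ∉ Λ ∧ (k < k₂ → ((![k, m], 1) : HexVertex) ∈ Λ)) → (∀ k : ℤ, k₁ ≤ k → k ≤ k₂ → s(((![k, m - 1], 1) : HexVertex), ((![k, m], 0) : HexVertex)) ≠ s(u, w)) → ∀ (kb ke : ℤ), k₁ ≤ kb → kb ≤ k₂ → k₁ ≤ ke → ke ≤ k₂ → hexParafermionicObservable Λ s(u, w) hexCriticalFugacity (5 / 8) s(((![ke, m - 1], 1) : HexVertex), ((![ke, m], 0) : HexVertex)) / hexParafermionicObservable Λ s(u, w) hexCriticalFugacity (5 / 8) s(((![kb, m - 1], 1) : HexVertex), ((![kb, m], 0) : HexVertex)) = hexParafermionicObservable Λ s(u, w)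 hexCriticalFugacity 0 s(((![ke, m - 1], 1) : HexVertex), ((![ke, m], 0) : HexVertex)) / hexParafermionicObservable Λ s(u, w) hexCriticalFugacity 0 s(((![kb, m - 1], 1) : HexVertex), ((![kb, m], 0) : HexVertex)) :=
  fun _ hΛ _ _ huw hu hw _ _ _ hF hroot _ _ hkb₁ hkb₂ hke₁ hke₂ =>
    dartRatio_eq_massRatio hΛ huw hu hw hF hroot hkb₁ hkb₂ hke₁ hke₂

end Summit.CriticalPhenomena.SAWScalingLimit.Theorems.PolygonParitySqueeze.GateTrace

end
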